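import Summits.HodgeConjecture.HodgeConjecture.Theorems.R90S1KeysTrichotomyUnramified          -- ★ p861649 (this seat): `keys_trichotomy_of_unramified` (socket A2 under `hU`: `(χ₁, χ₂)` trivial on `T ∩ K_v`)
import Summits.HodgeConjecture.HodgeConjecture.Theorems.K2E3KeysThmTwoUnramifiedLineReduction   -- ★ `cmTorusCharPair_one_eq_one_of_unramified` (`χ₁∣𝒪_vˣ = 1 ⇒ (χ₁, 1)` trivial on `T ∩ K_v`); brings ★ `K2E3PrincipalSeriesDetTwist.reducible_iff_reducible_one`
import HarnessLib

/-!
# R90-TF · S1 «Ch. 12.2 local, non-split `v`» — KEYS' TRICHOTOMY (socket A2) UNCONDITIONALLY FOR EVERY UNRAMIFIED `χ₁` AND EVERY `χ₂`, AT EVERY NON-SPLIT PLACE: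
# `i_G(χ₁, χ₂)` reducible ⟺ `χ₁` in Keys' case (1), (2) or (3)  [Rogawski1990 §12.2 p. 173 ll. 8–12; Keys1984 §7 Thm. (1)–(2) p. 126]

Cell `hodgecm-mathlib`, crux H413 (`stmt-HodgeConjecture-24833`), route of record `HCCMUnconditional`; programme R90-TF (brief `director/R90-BRIEF.v2.md`
1f40d54518340a35), section S1 = Ch. 12.2 local (base `R90-C10`), seat R90-C10-p04 (g0), socket S1#3 = A2 `R90.S1.stub_R90_122_keys_trichotomy` of
`Cruxes/H413/Lines/R90_S1_NonsplitLocalPacketsA.lean`, ROAD «⇐ + FRAME» — brick (F-d): the frame ★ (F-b) `keys_trichotomy_of_unramified` with its hypothesis `hU`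
(«`(χ₁, χ₂)` trivial on `T ∩ K_v`», which forces `χ₂ = 1`, ★ `eq_one_of_levelTrivial`) weakened to «`χ₁` trivial on `𝒪_vˣ`», `χ₂` ARBITRARY.  Helper file, lane
`--supports stmt-HodgeConjecture-24833 --as helper`; ONE theorem, no definition, no instance, no notation, no `sorry`; ★-only imports (never a `Cruxes/…/Lines` module; §0
vocabulary pasted unfolded).  HONEST LABEL: HC_CM is proved only modulo the 7 printed citations (2 remaining named inputs: hLiu418 = stmt-HodgeConjecture-24832,
h413 = stmt-HodgeConjecture-24833) until rung 0 closes; count-neutral ★-assembly.  SCOPE (honest): after this file the residue of socket A2 is exactly «`χ₁` RAMIFIED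
(conductor ≥ 1), `χ₁` non-unitary: `i_G(χ₁, χ₂)` reducible ⇒ (1) ∨ (2)» — by ★ `K2E3PrincipalSeriesDetTwist.reducible_iff_reducible_one` equivalently at `χ₂ = 1` —
[Keys1984 §4–§6, the rank-one intertwining operator at positive conductor] (seat p05's road; the K2E3 census (D59) leaf (U4f-χ₁-ram-one)).

WHY `χ₂` DROPS OUT ([Rogawski1990, §12.1 p. 171; §12.2 p. 173]: the list (1)(2)(3) constrains `χ₁` only).  In print's (= the tree's ★ `torusCharPair`) coordinates
`χ(d(α, β, ᾱ⁻¹)) = χ₁(α)·χ₂(det d)`, so `i_G(χ₁, χ₂) = i_G(χ₁, 1) ⊗ (χ₂ ∘ det_G)` and twisting by a character of `G` preserves the lattice of `G`-subrepresentations: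
★ `reducible_iff_reducible_one` («`i_G(χ₁, χ₂)` reducible ⟺ `i_G(χ₁, 1)` reducible»).  At `χ₂ = 1` an unramified `χ₁` makes `(χ₁, 1)` trivial on `T ∩ K_v`
(★ `cmTorusCharPair_one_eq_one_of_unramified`), where ★ (F-b) applies; its right-hand side does not mention `χ₂`.

## References
* [Rogawski1990] J. D. Rogawski, *Automorphic Representations of Unitary Groups in Three Variables*, Ann. of Math. Stud. 123 (1990): §12.1 p. 171; §12.2 (1)–(3) p. 173.
* [Keys1984] D. Keys, *Principal series representations of special unitary groups over local fields*, Compositio Math. 51 (1984) 115–130: §7 Theorem (1)–(2) p. 126.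
* [BernsteinZelevinsky1977] I. N. Bernstein, A. V. Zelevinsky, *Induced representations of reductive p-adic groups I*, Ann. Sci. ÉNS 10 (1977): Prop. 1.9 (f), Thm. 2.9.
* [Casselman1980] W. Casselman, *The unramified principal series of p-adic groups I*, Compositio Math. 40 (1980): §3.
-/

set_option autoImplicit false
-- the mandated namespace repeats the single-problem summit's segment (`HodgeConjecture.HodgeConjecture`)
set_option linter.dupNamespace false

noncomputable section

open NumberField IsDedekindDomain
open scoped Matrix

open Literature.NumberTheory Literature.NumberTheory.Automorphic Literature.NumberTheory.Automorphic.UnitaryGroup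
open Literature.NumberTheory.Rogawski1990
open Summit.HodgeConjecture.HodgeConjecture.Cruxes.H413

namespace Summit.HodgeConjecture.HodgeConjecture.R90.S1

variable (L : Type) [Field L] [NumberField L] [IsCMField L]

set_option synthInstance.maxHeartbeats 400000 in
set_option maxHeartbeats 3200000 in
-- statement-heavy: the `SmoothInd` carrier of `cmPrincipalSeries` (same budget class as ★ (F-b))
/-- **KEYS' TRICHOTOMY FOR AN UNRAMIFIED `χ₁` AND ANY `χ₂`, AT EVERY NON-SPLIT PLACE — socket A2 `R90.S1.stub_R90_122_keys_trichotomy` TOKEN FOR TOKEN (§0 `def`s unfolded) under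
the single extra hypothesis `hunr` («`χ₁ = 1` on `𝒪_vˣ = (Π_{w∣v} 𝒪_w)ˣ`»).**  At a non-split finite place `v` of `L⁺`, for continuous `χ₁, χ₂` with `χ₁` unramified: `i_G(χ₁, χ₂)` has a
`G`-stable `⊥ ≠ N ≠ ⊤` iff (1) `χ₁ = ‖·‖^{±1}` (`‖·‖ = halfModulusChar²`), or (2) `χ₁ = η‖·‖^{±1/2}` with `η∣_{F_v^×} = ω_{E_w/F_v}`, `η` continuous, or (3) `χ₁ ≠ 1` and `χ₁∣_{F_v^×} = 1`.
Proof: ★ `reducible_iff_reducible_one` moves to `χ₂ = 1`; there `(χ₁, 1)` is trivial on `T ∩ K_v` (★ `cmTorusCharPair_one_eq_one_of_unramified`) and ★ (F-b) `keys_trichotomy_of_unramified`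
applies (its right-hand side is `χ₂`-free). [cite: Rogawski1990, §12.1 p. 171; §12.2 (1)–(3) p. 173] [cite: Keys1984, §7 Theorem (1)–(2) p. 126] [cite: BernsteinZelevinsky1977, Prop. 1.9 (f)] -/
theorem keys_trichotomy_of_unramifiedChar (v : HeightOneSpectrum (𝓞 ↥(maximalRealSubfield L)))
    (hns : ∀ w : PlacesOver L v, IsCMField.complexConj L • w.1 = w.1)
    (χ₁ : (LocalRing L v)ˣ →* ℂˣ) (χ₂ : ↥(normOneUnits (conjLocal L (IsCMField.complexConj L) v)) →* ℂˣ)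
    (h1c : Continuous fun x => ((χ₁ x : ℂˣ) : ℂ)) (h2c : Continuous fun x => ((χ₂ x : ℂˣ) : ℂ))
    (hunr : ∀ u ∈ (Submonoid.pi Set.univ (fun w : PlacesOver L v => (w.1.adicCompletionIntegers L).toSubring.toSubmonoid)).units, χ₁ u = 1) :
    (∃ N : Subrepresentation (cmPrincipalSeries L 3 v (cmTorusCharPair L v χ₁ χ₂)), N ≠ ⊥ ∧ N ≠ ⊤) ↔
      ((χ₁ = halfModulusChar (LocalRing L v) * halfModulusChar (LocalRing L v) ∨
          χ₁ = (halfModulusChar (LocalRing L v) * halfModulusChar (LocalRing L v))⁻¹) ∨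
        (∃ η : (LocalRing L v)ˣ →* ℂˣ, IsQuadraticCharExtension (conjLocal L (IsCMField.complexConj L) v) η ∧
          Continuous (fun x => ((η x : ℂˣ) : ℂ)) ∧
          (χ₁ = η * halfModulusChar (LocalRing L v) ∨ χ₁ = η * (halfModulusChar (LocalRing L v))⁻¹)) ∨
        (χ₁ ≠ 1 ∧ ∀ x : (LocalRing L v)ˣ, conjLocal L (IsCMField.complexConj L) v (x : LocalRing L v) = x → χ₁ x = 1)) :=
  (K2E3PrincipalSeriesDetTwist.reducible_iff_reducible_one L v χ₁ χ₂ h2c).trans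
    (keys_trichotomy_of_unramified L v hns χ₁ 1 h1c continuous_const
      (K2E3KeysThmTwoUnramifiedLineReduction.cmTorusCharPair_one_eq_one_of_unramified L v hns χ₁ hunr))

end Summit.HodgeConjecture.HodgeConjecture.R90.S1

end
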